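import Literature.NumberTheory.LFunctions.Zhang2022.TypedSection03
import Literature.NumberTheory.LFunctions.Zhang2022.Section3Lemma35Holds
import Literature.NumberTheory.LFunctions.Zhang2022.Section3Lemma36Holds
import Literature.NumberTheory.LFunctions.Zhang2022.Section3SigmaMajorant
import HarnessLib

/-!
# Zhang (2022), §3 proof-step nodes DISCHARGED: the two second moments of (3.5)/(3.6)
# (`Z22:§3.u021`, `Z22:§3.u025`), the majorant `|ς(n)| ≤ ν(n)τ₂(n)` (`Z22:§3.u024`) and the
# support of `ς` (tex L846)

Topic `Literature/NumberTheory/LFunctions/Zhang2022` (Landau–Siegel audit tree; verdict-neutral).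
Y. Zhang, *Discrete mean estimates and the Landau–Siegel zero*, arXiv:2211.02515v1 (2022)
[Zhang2022LandauSiegel] — **an unrefereed manuscript under adjudication; nothing here asserts or
denies its Theorems 1–2.** Campaign D-0069, layer L1, §3 [Z22 pp.15–16, tex L829–L858]. The typed
file `TypedSection03` states the proof-internal claims of §3 as named `Prop`s; this file PROVES four
of them (theorems only, no new definitions, no facts):

* `step3u021a_holds : Section3.Step3u021a` — `Z22:§3.u021`, first «≪» [Z22 p.15, tex L829]:
  «Assume that (A) holds. By Cauchy's inequality, the second assertion of Lemma 3.2 [= 3.3] and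
  Lemma 3.1, `Σ_{ψ∈Ψ}(|X₃(P²,ψ)| + ∫_{D⁴}^{P²}|X₃(x,ψ)|dx/x)² ≪ P²𝓛⁻¹⁹⁹³`» — from the tree's
  Lemma 3.1 (`Lemma31.lemma_3_1`), the large-sieve second moment `Skeleton.moment35_le`
  (`Section3Lemma35Holds`; Lemma 3.3 (ii) + Cauchy–Schwarz in `dx/x`) and the sizes of §2
  (`2 + 2log²(P²/D⁴) ≤ 9𝓛¹⁸`, `⌊P²⌋ + 1 + 2Q² ≤ 20P²`): constant `180·C₁`;
* `step3u025_holds : Section3.Step3u025` — `Z22:§3.u025` [Z22 p.16, tex L855]: «Assume that (A)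
  holds. … `Σ_{ψ∈Ψ}(|X₄(D⁸,ψ)| + ∫_{D⁴}^{D⁸}|X₄(x,ψ)|dx/x)² ≪ 𝔓𝓛⁻²⁰⁰⁵`» — the first conjunct of
  the tree's `Lemma36.lemma_3_6` (input-free route), transported by `Skeleton.lhs36_eq`;
* `step3u024_holds : Section3.Step3u024` — `Z22:§3.u024` [Z22 p.16, tex L851]: «It is direct to
  verify that `|ς(n)| ≤ Σ_{n=lm}ν(l)|υ(m)| ≤ ν(n)τ₂(n)`» — the tree's
  `SigmaMajorant.abs_sigmaTrunc_le_sigmaMajorant` / `sigmaMajorant_le_card_mul_nuOf` (both sides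
  multiplicative, compared at prime powers), transported by the bridges
  `Skeleton.nu/ups/sig = ofReal ∘ nuOf/upsilonOf/sigma36` of `Section3Lemma36Holds`;
* `sigSupport_holds : Section3.SigSupport` — [Z22 p.15, tex L846]: «We have `ς(n) = 0` unless
  `n = 1` or `D⁴ < n ≤ D⁸`» — for `1 < n ≤ D⁴` the cut is vacuous and `(ν ∗ υ)(n) = δ(n) = 0`
  (`Zhang2022.nuOf_mul_upsilonOf`), for `n > D⁸` no factorisation `n = lm` has `l, m ≤ D⁴`.

The finite-sum bridge `finsum_chr_le_sum_primeWindow` (`Σᶠ_{ψ∈Ψ} g ≤ Σ_{p∼P} Σ*_{ψ mod p} g` for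
`g ≥ 0`, by the injection `ψ ↦ ⟨p, ψ⟩`) converts the tree's double sums into the skeleton's `∑ᶠ`
over the type `Ψ = Skeleton.Chr D`. With `Section3.lemma35_of_moment` / `lemma36_of_moment`
(`TypedSection03Edges`) these make the printed chains «second moment ⇒ Lemma 3.5 / 3.6» kernel
theorems end to end. WHAT THIS IS NOT: any statement about Theorems 1–2 or Landau–Siegel zeros.

## References

* Y. Zhang, arXiv:2211.02515v1 (2022), §3 pp. 15–16. [cite: Zhang2022LandauSiegel, §3 pp. 15–16]
-/

noncomputable section

open Complex Real Finset MeasureTheory ArithmeticFunction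

namespace Literature.NumberTheory.LFunctions.Zhang2022.Section3

open Literature.NumberTheory.LFunctions.DirichletAbel (reChar reChar_one abs_reChar_le_one)
open Lemma36 (twist36)

/-! ## The finite-sum bridge `Ψ ↪ Σ_{p ∼ P} {ψ mod p primitive}` -/

open scoped Classical in
/-- For a non-negative summand, the skeleton's sum over the type `Ψ = Chr D` is at most the tree's
double sum over the window `p ∼ P` and the primitive characters mod `p` (the map `ψ ↦ ⟨p, ψ⟩` is
injective; in fact the two sums are equal). [cite: Zhang2022LandauSiegel, §2 p. 4] -/
theorem finsum_chr_le_sum_primeWindow {D : ℕ} (g : (p : ℕ) → DirichletCharacter ℂ p → ℝ)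
    (hg : ∀ p ψ, 0 ≤ g p ψ) :
    ∑ᶠ x : Skeleton.Chr D, g x.p x.ψ ≤
      ∑ p ∈ Skeleton.primeWindow D, ∑ ψ : DirichletCharacter ℂ p with ψ.IsPrimitive, g p ψ := by
  haveI : Fintype (Skeleton.Chr D) := Fintype.ofFinite _
  rw [finsum_eq_sum_of_fintype]
  have hinj : Function.Injective
      (fun x : Skeleton.Chr D => (⟨x.p, x.ψ⟩ : (p : ℕ) × DirichletCharacter ℂ p)) := by
    rintro ⟨p, hp, ψ, hψ⟩ ⟨p', hp', ψ', hψ'⟩ h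
    simp only [Sigma.mk.injEq] at h
    obtain ⟨rfl, h2⟩ := h
    simp only [heq_eq_eq] at h2
    subst h2
    rfl
  have hsub : Finset.univ.image
      (fun x : Skeleton.Chr D => (⟨x.p, x.ψ⟩ : (p : ℕ) × DirichletCharacter ℂ p)) ⊆
      (Skeleton.primeWindow D).sigma fun p =>
        Finset.univ.filter fun ψ : DirichletCharacter ℂ p => ψ.IsPrimitive := by
    intro y hy
    obtain ⟨x, -, rfl⟩ := Finset.mem_image.mp hy
    exact Finset.mem_sigma.mpr ⟨x.mem, Finset.mem_filter.mpr ⟨Finset.mem_univ _, x.prim⟩⟩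
  calc ∑ x : Skeleton.Chr D, g x.p x.ψ
      = ∑ y ∈ Finset.univ.image
          (fun x : Skeleton.Chr D => (⟨x.p, x.ψ⟩ : (p : ℕ) × DirichletCharacter ℂ p)), g y.1 y.2 := by
        rw [Finset.sum_image fun x _ x' _ h => hinj h]
    _ ≤ ∑ y ∈ (Skeleton.primeWindow D).sigma fun p =>
          Finset.univ.filter fun ψ : DirichletCharacter ℂ p => ψ.IsPrimitive, g y.1 y.2 :=
        Finset.sum_le_sum_of_subset_of_nonneg hsub fun y _ _ => hg _ _
    _ = ∑ p ∈ Skeleton.primeWindow D, ∑ ψ : DirichletCharacter ℂ p with ψ.IsPrimitive, g p ψ := by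
        rw [Finset.sum_sigma]

/-- `log D ≥ 3` once `D ≥ ⌈e³⌉`. [folklore] -/
private theorem three_le_log_of_ceil_le {D : ℕ} (hD : ⌈Real.exp 3⌉₊ ≤ D) : 3 ≤ Real.log D := by
  have h : Real.exp 3 ≤ D := le_trans (Nat.le_ceil _) (by exact_mod_cast hD)
  exact (Real.le_log_iff_exp_le (lt_of_lt_of_le (Real.exp_pos _) h)).mpr h

/-! ## `Z22:§3.u025`: the second moment of the left side of (3.6) -/

/-- **`Z22:§3.u025` HOLDS** [Z22 p.16, tex L855]: under (A), for `D` large,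
`Σ_{ψ∈Ψ}(|X₄(D⁸,ψ)| + ∫_{D⁴}^{D⁸}|X₄(x,ψ)|dx/x)² ≤ C𝔓𝓛⁻²⁰⁰⁵` — the first conjunct of the tree's
`Lemma36.lemma_3_6` (orthogonality at every height `≤ D⁸ < p ∼ P`, Cauchy–Schwarz in `dx/x`, and the
input-free bound `∑ ς²/n ≪ 𝓛⁻²⁰⁰⁷`), moved to the skeleton's `∑ᶠ` over `Ψ`.
[cite: Zhang2022LandauSiegel, §3 p.16 (proof of Lemma 3.6)] -/
theorem step3u025_holds : Step3u025 := by
  classical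
  obtain ⟨C, hC⟩ := Lemma36.lemma_3_6
  refine ⟨C, ⌈Real.exp 3⌉₊, fun D _ χ hD hq hp hA => ?_⟩
  have hlog : 3 ≤ Real.log D := three_le_log_of_ceil_le hD
  have hχ2 : χ ^ 2 = 1 := hq.sq_eq_one
  have hA' : ‖χ.LFunction 1‖ ≤ 1 / Real.log D ^ 2022 := le_of_lt hA
  have hs0 : (Skeleton.s0 D).re = 1 / 2 := by simp [Skeleton.s0, SmoothWeight.s0]
  have hM : ∀ p ∈ Skeleton.primeWindow D, D ^ 8 < p := fun p hp' =>
    Skeleton.eight_pow_lt_of_mem_primeWindow hlog hp'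
  obtain ⟨hmom, -⟩ := hC D χ hp hχ2 hlog hA' (Skeleton.s0 D) hs0 (Skeleton.primeWindow D) hM
  calc ∑ᶠ x : Skeleton.Chr D, lhs36 χ x ^ 2
      = ∑ᶠ x : Skeleton.Chr D, Lemma36.lhs36 χ (Skeleton.s0 D) x.ψ ^ 2 := by
        refine finsum_congr fun x => ?_
        rw [lhs36, Skeleton.lhs36_eq χ hχ2 x]
    _ ≤ ∑ p ∈ Skeleton.primeWindow D, ∑ ψ : DirichletCharacter ℂ p with ψ.IsPrimitive,
          Lemma36.lhs36 χ (Skeleton.s0 D) ψ ^ 2 :=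
        finsum_chr_le_sum_primeWindow (fun p ψ => Lemma36.lhs36 χ (Skeleton.s0 D) ψ ^ 2)
          fun _ _ => sq_nonneg _
    _ ≤ C * (∑ p ∈ Skeleton.primeWindow D, (p : ℝ)) / Real.log D ^ 2005 := hmom
    _ = C * frakP D * (Skeleton.ell D ^ 2005)⁻¹ := by
        rw [Skeleton.frakP_eq_sum_primeWindow, Skeleton.ell, div_eq_mul_inv]

/-- `Step3u025` — `_holds` alias of `step3u025_holds` above under the fact's exact name (appended
2026-08-28, D-0026 bookkeeping: the proof term is the existing theorem of this file; no statement,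
definition or attribute is edited; no new named fact; the ledger's debt table listed the fact
unproved). [cite: Zhang2022LandauSiegel, §3 p.16 (proof of Lemma 3.6)] -/
theorem _root_.Literature.NumberTheory.LFunctions.Zhang2022.Section3.Step3u025_holds : Step3u025 :=
  _root_.Literature.NumberTheory.LFunctions.Zhang2022.Section3.step3u025_holds

/-! ## `Z22:§3.u021` (first `≪`): the second moment of the left side of (3.5) -/

/-- **`Z22:§3.u021`, first «≪», HOLDS** [Z22 p.15, tex L829]: under (A), for `D` large,
`Σ_{ψ∈Ψ}(|X₃(P²,ψ)| + ∫_{D⁴}^{P²}|X₃(x,ψ)|dx/x)² ≤ 180C₁·P²𝓛⁻¹⁹⁹³`, by the printed route: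
the large sieve (Lemma 3.3 (ii)) at every height `≤ P²` and Cauchy–Schwarz in `dx/x`
(`Skeleton.moment35_le`), with the weight `Σ_{D⁴<n≤P²}|ν(n)|²/n ≤ C₁𝓛⁻²⁰¹¹` from Lemma 3.1
(`Lemma31.lemma_3_1`), `2 + 2log²(P²/D⁴) ≤ 9𝓛¹⁸` and `⌊P²⌋ + 1 + 2Q² ≤ 20P²`
(`Q = ⌈P(1+𝓛⁻⁶⁸)⌉ ≤ 3P`). [cite: Zhang2022LandauSiegel, §3 p.15 (proof of Lemma 3.5)] -/
theorem step3u021a_holds : Step3u021a := by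
  classical
  obtain ⟨C₁, hC₁⟩ := Lemma31.lemma_3_1
  refine ⟨180 * max C₁ 0, ⌈Real.exp 3⌉₊, fun D _ χ hD hq hp hA => ?_⟩
  have hlog : 3 ≤ Real.log D := three_le_log_of_ceil_le hD
  have hχ2 : χ ^ 2 = 1 := hq.sq_eq_one
  have hA' : ‖χ.LFunction 1‖ ≤ 1 / Real.log D ^ 2022 := le_of_lt hA
  have hs0 : (Skeleton.s0 D).re = 1 / 2 := by simp [Skeleton.s0, SmoothWeight.s0]
  set L : ℝ := Real.log D with hLdef
  have hL1 : 1 ≤ L := by linarith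
  have hL0 : 0 < L := by linarith
  have hLne : L ≠ 0 := hL0.ne'
  set Cm : ℝ := max C₁ 0 with hCm
  have hCm0 : 0 ≤ Cm := le_max_right _ _
  -- the objects
  set A : ℕ := D ^ 4 with hAdef
  set b : ℝ := Skeleton.bigP D ^ 2 with hbdef
  set Q : ℕ := ⌈Skeleton.bigP D * (1 + (Skeleton.ell D ^ 68)⁻¹)⌉₊ with hQdef
  have hApos : 0 < A := pow_pos (Nat.pos_of_ne_zero (NeZero.ne D)) 4
  have hAb : (A : ℝ) ≤ b := Skeleton.pow_four_le_bigP_sq hlog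
  have hP1 : 1 ≤ Skeleton.bigP D := by
    rw [Skeleton.bigP]; exact Real.one_le_exp (by rw [Skeleton.ell]; positivity)
  have hb1 : 1 ≤ b := one_le_pow₀ hP1
  -- Lemma 3.1 at `N = ⌊P²⌋`: the weight `W ≤ C₁𝓛⁻²⁰¹¹`
  set W : ℝ := ∑ n ∈ Ioc A ⌊b⌋₊,
    ‖Skeleton.nu χ n‖ ^ 2 * (n : ℝ) ^ (-(2 * (Skeleton.s0 D).re)) with hWdef
  have hW : W ≤ Cm / L ^ 2011 := by
    have hN : (⌊b⌋₊ : ℝ) ≤ Real.exp (2 * Real.log D ^ 9) := by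
      rw [← Skeleton.bigP_sq_eq]; exact Nat.floor_le (by positivity)
    have h31 := hC₁ D χ hp hχ2 hlog hA' ⌊b⌋₊ hN
    have hWeq : W = ∑ n ∈ Ioc A ⌊b⌋₊, ‖divisorSumChar χ n‖ ^ 2 / n := by
      refine sum_congr rfl fun n _ => ?_
      rw [hs0, show -(2 * (1 / 2 : ℝ)) = -1 by norm_num, Real.rpow_neg_one, div_eq_mul_inv]
      rfl
    rw [hWeq]
    exact h31.trans (div_le_div_of_nonneg_right (le_max_left _ _) (by positivity))
  -- the generic large-sieve moment bound
  have hmom := Skeleton.moment35_le (Skeleton.nu χ) (Skeleton.s0 D) hApos hAb Q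
    (Skeleton.primeWindow D) (Skeleton.primeWindow_subset_Icc D)
  -- the constants: `2 + 2log²(b/A) ≤ 9𝓛¹⁸`, `⌊b⌋ + 1 + 2Q² ≤ 20P²`
  have hlogc : 2 + 2 * Real.log (b / A) ^ 2 ≤ 9 * L ^ 18 := by
    have ha : (0 : ℝ) < A := Nat.cast_pos.mpr hApos
    have hA1 : (1 : ℝ) ≤ A := by exact_mod_cast hApos
    have hlo : 0 ≤ Real.log (b / A) := Real.log_nonneg ((one_le_div ha).mpr hAb)
    have hhi : Real.log (b / A) ≤ 2 * L ^ 9 := by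
      have h1 : b / A ≤ b := div_le_self (by positivity) hA1
      calc Real.log (b / A) ≤ Real.log b := Real.log_le_log (by positivity) h1
        _ = 2 * L ^ 9 := by rw [hbdef, Skeleton.bigP_sq_eq, Real.log_exp]
    have hsq : Real.log (b / A) ^ 2 ≤ (2 * L ^ 9) ^ 2 := pow_le_pow_left₀ hlo hhi 2
    have h18 : (2 : ℝ) ≤ L ^ 18 := le_trans (by norm_num) (pow_le_pow_left₀ (by norm_num) hlog 18)
    nlinarith [hsq, h18]
  have hKc : (⌊b⌋₊ : ℝ) + 1 + 2 * (Q : ℝ) ^ 2 ≤ 20 * Skeleton.bigP D ^ 2 := by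
    have hfl : (⌊b⌋₊ : ℝ) ≤ b := Nat.floor_le (by positivity)
    have hQ : (Q : ℝ) ≤ 3 * Skeleton.bigP D :=
      Skeleton.ceil_window_le (by rw [← hLdef]; exact hL1)
    have hQ0 : (0 : ℝ) ≤ Q := Nat.cast_nonneg Q
    nlinarith [hfl, hQ, hQ0, hb1, hP1]
  have hW0 : 0 ≤ W := sum_nonneg fun n _ =>
    mul_nonneg (sq_nonneg _) (Real.rpow_nonneg (Nat.cast_nonneg n) _)
  -- the moment: `≤ 9𝓛¹⁸ · 20P² · C₁𝓛⁻²⁰¹¹`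
  have hT : ∑ p ∈ Skeleton.primeWindow D, ∑ ψ : DirichletCharacter ℂ p with ψ.IsPrimitive,
      (‖twist36 (Skeleton.nu χ) A (Skeleton.s0 D) ψ ⌊b⌋₊‖ +
        ∫ x in (A : ℝ)..b, ‖twist36 (Skeleton.nu χ) A (Skeleton.s0 D) ψ ⌊x⌋₊‖ / x) ^ 2 ≤
      9 * L ^ 18 * (20 * Skeleton.bigP D ^ 2) * (Cm / L ^ 2011) := by
    refine hmom.trans ?_
    exact mul_le_mul (mul_le_mul hlogc hKc (by positivity) (by positivity)) hW hW0 (by positivity)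
  -- move to the skeleton's `∑ᶠ` over `Ψ`
  calc ∑ᶠ x : Skeleton.Chr D, lhs35 χ x ^ 2
      = ∑ᶠ x : Skeleton.Chr D, (‖twist36 (Skeleton.nu χ) A (Skeleton.s0 D) x.ψ ⌊b⌋₊‖ +
          ∫ y in (A : ℝ)..b, ‖twist36 (Skeleton.nu χ) A (Skeleton.s0 D) x.ψ ⌊y⌋₊‖ / y) ^ 2 := by
        refine finsum_congr fun x => ?_
        rw [lhs35, Skeleton.lhs35_eq χ x, hAdef, hbdef]
    _ ≤ ∑ p ∈ Skeleton.primeWindow D, ∑ ψ : DirichletCharacter ℂ p with ψ.IsPrimitive,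
          (‖twist36 (Skeleton.nu χ) A (Skeleton.s0 D) ψ ⌊b⌋₊‖ +
            ∫ y in (A : ℝ)..b, ‖twist36 (Skeleton.nu χ) A (Skeleton.s0 D) ψ ⌊y⌋₊‖ / y) ^ 2 :=
        finsum_chr_le_sum_primeWindow
          (fun p ψ => (‖twist36 (Skeleton.nu χ) A (Skeleton.s0 D) ψ ⌊b⌋₊‖ +
            ∫ y in (A : ℝ)..b, ‖twist36 (Skeleton.nu χ) A (Skeleton.s0 D) ψ ⌊y⌋₊‖ / y) ^ 2)
          fun _ _ => sq_nonneg _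
    _ ≤ 9 * L ^ 18 * (20 * Skeleton.bigP D ^ 2) * (Cm / L ^ 2011) := hT
    _ = 180 * max C₁ 0 * Skeleton.bigP D ^ 2 * (Skeleton.ell D ^ 1993)⁻¹ := by
        rw [hCm, Skeleton.ell, ← hLdef, show (2011 : ℕ) = 18 + 1993 from rfl, pow_add]
        field_simp
        ring

/-- `Step3u021a` — `_holds` alias of `step3u021a_holds` above under the fact's exact name (appended
2026-08-28, D-0026 bookkeeping: the proof term is the existing theorem of this file; no statement,
definition or attribute is edited; no new named fact; the ledger's debt table listed the fact
unproved). [cite: Zhang2022LandauSiegel, §3 p.15 (proof of Lemma 3.5)] -/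
theorem _root_.Literature.NumberTheory.LFunctions.Zhang2022.Section3.Step3u021a_holds :
    Step3u021a :=
  _root_.Literature.NumberTheory.LFunctions.Zhang2022.Section3.step3u021a_holds

/-! ## `Z22:§3.u024`: the majorant of `ς` -/

/-- **`Z22:§3.u024` HOLDS** [Z22 p.16, tex L851]: «`|ς(n)| ≤ Σ_{n=lm} ν(l)|υ(m)| ≤ ν(n)τ₂(n)`» for
every `n` (quadratic `χ`): the truncation `l, m ≤ D⁴` only drops terms and `ν ≥ 0`
(`SigmaMajorant.abs_sigmaTrunc_le_sigmaMajorant`); then `ν ∗ |υ|` and `τ·ν` are both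
multiplicative and compare at prime powers (`SigmaMajorant.sigmaMajorant_le_card_mul_nuOf`).
[cite: Zhang2022LandauSiegel, §3 p.16 (proof of Lemma 3.6)] -/
theorem step3u024_holds : Step3u024 := by
  intro D _ χ n hq
  have hχ2 : χ ^ 2 = 1 := hq.sq_eq_one
  have hm := Lemma36Input.reChar_mul_all χ hχ2
  have h1 : reChar χ 1 = 1 := reChar_one χ
  have habs : ∀ k, |reChar χ k| ≤ 1 := abs_reChar_le_one χ
  have hA := SigmaMajorant.abs_sigmaTrunc_le_sigmaMajorant hm h1 habs (D ^ 4) n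
  have hB := SigmaMajorant.sigmaMajorant_le_card_mul_nuOf hm h1 habs n
  have e1 : ‖Skeleton.sig χ n‖ =
      |sigmaTrunc (nuOf (reChar χ)) (upsilonOf (reChar χ)) (D ^ 4) n| := by
    rw [Skeleton.sig_eq_ofReal_sigma36 χ hχ2, Complex.norm_real, Real.norm_eq_abs, Lemma36.sigma36]
  have e2 : ∑ lm ∈ n.divisorsAntidiagonal, (Skeleton.nu χ lm.1).re * ‖Skeleton.ups χ lm.2‖ =
      SigmaMajorant.sigmaMajorant (reChar χ) n := by
    rw [SigmaMajorant.sigmaMajorant_apply]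
    refine Finset.sum_congr rfl fun lm _ => ?_
    rw [Skeleton.nu_eq_ofReal_nuOf χ hχ2, Complex.ofReal_re, Skeleton.ups_eq_ofReal_upsilonOf χ hχ2,
      Complex.norm_real, Real.norm_eq_abs]
  have e3 : (Skeleton.nu χ n).re * (n.divisors.card : ℝ) =
      (n.divisors.card : ℝ) * nuOf (reChar χ) n := by
    rw [Skeleton.nu_eq_ofReal_nuOf χ hχ2, Complex.ofReal_re, mul_comm]
  refine ⟨?_, ?_⟩
  · rw [e1, e2]; exact hA
  · rw [e2, e3]; exact hB

/-- `Step3u024` — `_holds` alias of `step3u024_holds` above under the fact's exact name (appended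
2026-08-28, D-0026 bookkeeping: the proof term is the existing theorem of this file; no statement,
definition or attribute is edited; no new named fact; the ledger's debt table listed the fact
unproved). [cite: Zhang2022LandauSiegel, §3 p.16 (proof of Lemma 3.6)] -/
theorem _root_.Literature.NumberTheory.LFunctions.Zhang2022.Section3.Step3u024_holds : Step3u024 :=
  _root_.Literature.NumberTheory.LFunctions.Zhang2022.Section3.step3u024_holds

/-! ## The support of `ς` -/

/-- **[Z22 p.15, tex L846] «We have `ς(n) = 0` unless `n = 1` or `D⁴ < n ≤ D⁸`» HOLDS**
(quadratic `χ`): for `1 < n ≤ D⁴` every factorisation `n = lm` has `l, m ≤ D⁴`, so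
`ς(n) = (ν ∗ υ)(n) = δ(n) = 0` (`Zhang2022.nuOf_mul_upsilonOf`: `(1 ∗ χ) ∗ (μ ∗ μχ) = δ`); for
`n > D⁸ = D⁴·D⁴` no factorisation has both `l, m ≤ D⁴`; and `ς(0) = 0` (empty sum).
[cite: Zhang2022LandauSiegel, §3 p.15] -/
theorem sigSupport_holds : SigSupport := by
  classical
  intro D _ χ n hq hne
  have hχ2 : χ ^ 2 = 1 := hq.sq_eq_one
  by_cases h1 : n = 1
  · exact Or.inl h1
  by_cases h2 : D ^ 4 < n ∧ n ≤ D ^ 8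
  · exact Or.inr h2
  exfalso
  apply hne
  rw [Skeleton.sig_eq_ofReal_sigma36 χ hχ2, Complex.ofReal_eq_zero, Lemma36.sigma36, sigmaTrunc]
  rcases Nat.lt_or_ge (D ^ 8) n with h8 | h8
  · -- `n > D⁸`: no factorisation with both factors `≤ D⁴`
    refine Finset.sum_eq_zero fun x hx => ?_
    exfalso
    obtain ⟨hx, hle⟩ := Finset.mem_filter.mp hx
    have hprod : x.1 * x.2 = n := (Nat.mem_divisorsAntidiagonal.mp hx).1
    have hle' : n ≤ D ^ 8 :=
      calc n = x.1 * x.2 := hprod.symm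
        _ ≤ D ^ 4 * D ^ 4 := Nat.mul_le_mul hle.1 hle.2
        _ = D ^ 8 := by rw [← pow_add]
    exact absurd hle' (not_le.mpr h8)
  · -- `n ≤ D⁸` and not `D⁴ < n ≤ D⁸`: so `n ≤ D⁴`
    have h4 : n ≤ D ^ 4 := by
      by_contra h
      exact h2 ⟨not_le.mp h, h8⟩
    rcases Nat.eq_zero_or_pos n with rfl | hn
    · simp
    · have hfull : (n.divisorsAntidiagonal.filter fun x => x.1 ≤ D ^ 4 ∧ x.2 ≤ D ^ 4) =
          n.divisorsAntidiagonal := by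
        refine Finset.filter_true_of_mem fun x hx => ?_
        have h := (Nat.mem_divisorsAntidiagonal.mp hx).1
        constructor
        · exact le_trans (Nat.le_of_dvd hn ⟨x.2, h.symm⟩) h4
        · exact le_trans (Nat.le_of_dvd hn ⟨x.1, by rw [mul_comm]; exact h.symm⟩) h4
      rw [hfull]
      have key := congrArg (fun F : ArithmeticFunction ℝ => F n)
        (nuOf_mul_upsilonOf (reChar χ) (Lemma36Input.reChar_mul_all χ hχ2) (reChar_one χ))
      simp only [ArithmeticFunction.mul_apply, ArithmeticFunction.one_apply, if_neg h1] at key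
      exact key

/-- `SigSupport` — `_holds` alias of `sigSupport_holds` above under the fact's exact name (appended
2026-08-28, D-0026 bookkeeping: the proof term is the existing theorem of this file; no statement,
definition or attribute is edited; no new named fact; the ledger's debt table listed the fact
unproved). [cite: Zhang2022LandauSiegel, §3 p.15] -/
theorem _root_.Literature.NumberTheory.LFunctions.Zhang2022.Section3.SigSupport_holds :
    SigSupport :=
  _root_.Literature.NumberTheory.LFunctions.Zhang2022.Section3.sigSupport_holds

end Literature.NumberTheory.LFunctions.Zhang2022.Section3

end
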